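import Summits.ValiantsHypothesis.ValiantsHypothesis.Theorems.LacunarySymmetroidMatrixDescartesCensusRealExponentsLocus
import Summits.ValiantsHypothesis.ValiantsHypothesis.Theorems.LacunarySymmetroidMatrixDescartesCensusChamberReduction
import Summits.ValiantsHypothesis.ValiantsHypothesis.Theorems.LacunarySymmetroidMatrixDescartesCensusMirror
import Summits.ValiantsHypothesis.ValiantsHypothesis.Theorems.LacunarySymmetroidMatrixDescartesCensusChamberTableB
import Summits.ValiantsHypothesis.ValiantsHypothesis.Theorems.LacunarySymmetroidMatrixDescartesDoorA26WallBubblingBubblingDefs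

/-!
# `DoorA26` — THE CENSUS → CLOSURE BRIDGE: chamber rows of the census keep the closure of the twenty-locus away

HONEST FRAMING.  Object-search cell `pub-symmetroid`, door-A target `DoorA26 := PosRootLawAt 2 6 19`
(stmt-ValiantsHypothesis-19979; OPEN, typed, never asserted).  Seat val-sym-door-p2 g16 (W1 / census-bridge).  A bookkeeping
bridge between the cell's two door-A lanes, deciding nothing about the door:

* the CENSUS lane proves INTEGER chamber rows `Census.doorA26_on_chamber<n> : ∀ d, StrictMono (pairSum d ∘ chamber n) →
  PosRootLawOn 2 6 19 d` (1 363 chambers of the 2 608 in the kernel, 2026-08-29);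
* the WALL-BUBBLING lane (`Cruxes/DoorA26/Lines/wall_bubbling*.lean`) needs statements «`δ₀ ∉ closure TwentyLocus`» at REAL
  exponent vectors `δ₀` of the sorted simplex (its obligations (W), (M), (R); e.g. `TripleStratum26`).

THE BRIDGE (`not_mem_closure_twentyLocus_of_rows`): for ANY `δ₀ ∈ ℝ⁶`, if every INTEGER support `d : Fin 6 → ℕ` whose pair sums
satisfy all the STRICT pair-sum inequalities of `δ₀` (`δ₀ᵢ + δ₀ⱼ < δ₀ₖ + δ₀ₗ ⇒ dᵢ + dⱼ < dₖ + dₗ`) carries the door-A row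
`PosRootLawOn 2 6 19 d`, then `δ₀ ∉ closure TwentyLocus`.  Proof: the twenty-locus `T` is OPEN (`isOpen_twentyLocus_two_six`);
the strict inequalities of `δ₀` persist on an open neighbourhood `U ∋ δ₀`; if `δ₀ ∈ closure T` then `U ∩ T` is open and non-empty,
so it contains a RATIONAL exponent vector (`ℚ⁶` is dense); clearing denominators and translating (`mem_locus`-affine invariance,
`ncard_rpow_affine`) gives an integer support `d ∈ T` inheriting the strict inequalities, and the integer row transfers to real
powers at `d` (`ncard_rpow_natCast_le_of_posRootLawOn`: `≤ 19` zeros) — contradiction with `≥ 20`.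

COROLLARIES.  `rows_of_sortedRows` (for MONOTONE `δ₀` only SORTED generic supports need rows: sort `d`, the sorting permutation
fixes `δ₀`, rows are permutation-invariant, collided supports are free); `not_mem_closure_twentyLocus_of_sortedRows`;
`not_mem_closure_twentyLocus_of_chamberRow` / `…_of_chamber` — **a point of the open cone of a chamber whose row is in the kernel is
not in the closure of the twenty-locus** (so `closure T ∩ Δ` lies in the closure of the union of the UNcertified chambers); the
`Bubbling.TwentyLocus` spellings for the W-line (`not_mem_closure_bubblingTwentyLocus_of_rows/…sortedRows`).

WHAT THIS IS NOT.  Not a row, not a certificate, not a statement about any particular chamber; every hypothesis is a census row to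
be supplied by name.  `DoorA26`, `TripleStratum26`, (W), (M), (R), `MatrixDescartes` (stmt-ValiantsHypothesis-18050) OPEN; registers
unchanged (`ζ_sym(2,6) ∈ {18,19,20}`); nothing on `VP ≠ VNP`.  `--supports stmt-ValiantsHypothesis-19979 --as helper`.

[folklore] Point-set topology (openness, density of `ℚ⁶`), clearing denominators, sorting a tuple (`Tuple.sort`); no citation
exists or is needed.
-/

-- `Summit.ValiantsHypothesis.ValiantsHypothesis.…` repeats a component by the D-0017 layout
-- (single-conjunct summit), which the `dupNamespace` linter flags; the name is mandated.
set_option linter.dupNamespace false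

namespace Summit.ValiantsHypothesis.ValiantsHypothesis.Theorems.LacunarySymmetroidMatrixDescartes.Census.RealExp

open Finset Filter Topology Polynomial
open scoped BigOperators Matrix
open Summit.ValiantsHypothesis.ValiantsHypothesis.Theorems.MatrixDescartes.Negative (PosRootLawAt)
open Summit.ValiantsHypothesis.ValiantsHypothesis.Theorems.SymmetroidDescartes (eval_det_pencil)

section IntegerToReal

variable {m K : ℕ}

/-- **An integer row transfers to real powers at its own support.**  If `PosRootLawOn m K B d` then every real
symmetric pencil `∑_l x^{(d_l : ℝ)} S_l` has at most `B` zeros on `(0,∞)` counted as `Set.ncard` (the polynomial's positive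
roots; if the determinant polynomial vanishes identically the zero set is `(0,∞)`, whose `ncard` is `0`). [folklore] -/
theorem ncard_rpow_natCast_le_of_posRootLawOn {B : ℕ} (d : Fin K → ℕ) (h : PosRootLawOn m K B d)
    (S : Fin K → Matrix (Fin m) (Fin m) ℝ) (hS : ∀ l, (S l).IsSymm) :
    {x : ℝ | 0 < x ∧ (∑ l, (x ^ ((d l : ℕ) : ℝ)) • S l).det = 0}.ncard ≤ B := by
  classical
  set P : ℝ[X] := (∑ l, (X : ℝ[X]) ^ d l • (S l).map C).det with hP
  by_cases hP0 : P = 0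
  · have hset : {x : ℝ | 0 < x ∧ (∑ l, (x ^ ((d l : ℕ) : ℝ)) • S l).det = 0} = Set.Ioi 0 := by
      ext x
      simp only [Set.mem_setOf_eq, Set.mem_Ioi, and_iff_left_iff_imp]
      intro _
      have h0 := congrArg (fun Q : ℝ[X] => Q.eval x) hP0
      simp only [hP, eval_det_pencil, eval_zero] at h0
      simpa only [Real.rpow_natCast] using h0
    rw [hset, Set.Infinite.ncard (Set.Ioi_infinite 0)]
    exact Nat.zero_le _
  · have hset : (↑(P.roots.toFinset.filter (fun x => 0 < x)) : Set ℝ) =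
        {x : ℝ | 0 < x ∧ (∑ l, (x ^ ((d l : ℕ) : ℝ)) • S l).det = 0} := by
      ext x
      rw [Finset.coe_filter, Set.mem_setOf_eq, Set.mem_setOf_eq, Multiset.mem_toFinset,
        mem_roots hP0, IsRoot.def, hP, eval_det_pencil]
      simp only [Real.rpow_natCast]
      exact and_comm
    rw [← hset, Set.ncard_coe_finset]
    exact h S hS

end IntegerToReal

section Bridge

/-- **THE CENSUS → CLOSURE BRIDGE.**  Let `δ₀ ∈ ℝ⁶` be arbitrary.  If every integer support `d` whose pair sums satisfy all
the STRICT pair-sum inequalities of `δ₀` carries the door-A row `PosRootLawOn 2 6 19 d`, then `δ₀` is not in the closure of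
the twenty-locus (the set of `isOpen_twentyLocus_two_six`, written out). [this work] -/
theorem not_mem_closure_twentyLocus_of_rows (δ₀ : Fin 6 → ℝ)
    (h : ∀ d : Fin 6 → ℕ,
      (∀ p q : Fin 6 × Fin 6, δ₀ p.1 + δ₀ p.2 < δ₀ q.1 + δ₀ q.2 → d p.1 + d p.2 < d q.1 + d q.2) →
      PosRootLawOn 2 6 19 d) :
    δ₀ ∉ closure {δ : Fin 6 → ℝ | ∃ S : Fin 6 → Matrix (Fin 2) (Fin 2) ℝ, (∀ l, (S l).IsSymm) ∧
      20 ≤ {x : ℝ | 0 < x ∧ (∑ l, (x ^ (δ l)) • S l).det = 0}.ncard} := by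
  classical
  intro hcl
  -- the open neighbourhood of `δ₀` on which its strict pair-sum inequalities persist
  set U : Set (Fin 6 → ℝ) := {δ | ∀ p q : Fin 6 × Fin 6, δ₀ p.1 + δ₀ p.2 < δ₀ q.1 + δ₀ q.2 →
      δ p.1 + δ p.2 < δ q.1 + δ q.2} with hU
  have hUeq : U = ⋂ p : Fin 6 × Fin 6, ⋂ q : Fin 6 × Fin 6,
      {δ : Fin 6 → ℝ | δ₀ p.1 + δ₀ p.2 < δ₀ q.1 + δ₀ q.2 → δ p.1 + δ p.2 < δ q.1 + δ q.2} := by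
    ext δ
    simp only [hU, Set.mem_setOf_eq, Set.mem_iInter]
  have hUopen : IsOpen U := by
    rw [hUeq]
    refine isOpen_iInter_of_finite fun p => isOpen_iInter_of_finite fun q => ?_
    by_cases hpq : δ₀ p.1 + δ₀ p.2 < δ₀ q.1 + δ₀ q.2
    · have : {δ : Fin 6 → ℝ | δ₀ p.1 + δ₀ p.2 < δ₀ q.1 + δ₀ q.2 → δ p.1 + δ p.2 < δ q.1 + δ q.2}
          = {δ : Fin 6 → ℝ | δ p.1 + δ p.2 < δ q.1 + δ q.2} := by
        ext δ; simp only [Set.mem_setOf_eq, hpq, forall_true_left]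
      rw [this]
      exact isOpen_lt (by fun_prop) (by fun_prop)
    · have : {δ : Fin 6 → ℝ | δ₀ p.1 + δ₀ p.2 < δ₀ q.1 + δ₀ q.2 → δ p.1 + δ p.2 < δ q.1 + δ q.2}
          = Set.univ := by
        ext δ; simp only [Set.mem_setOf_eq, hpq, IsEmpty.forall_iff, Set.mem_univ]
      rw [this]
      exact isOpen_univ
  have hU0 : δ₀ ∈ U := fun p q hpq => hpq
  -- the twenty-locus is open, so `U ∩ T` is open and, `δ₀` being in the closure, non-empty
  set T : Set (Fin 6 → ℝ) := {δ : Fin 6 → ℝ | ∃ S : Fin 6 → Matrix (Fin 2) (Fin 2) ℝ, (∀ l, (S l).IsSymm) ∧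
      20 ≤ {x : ℝ | 0 < x ∧ (∑ l, (x ^ (δ l)) • S l).det = 0}.ncard} with hT
  have hTopen : IsOpen T := isOpen_twentyLocus_two_six
  have hne : (U ∩ T).Nonempty := mem_closure_iff.mp hcl U hUopen hU0
  -- a RATIONAL exponent vector in `U ∩ T`
  set D : Set (Fin 6 → ℝ) := Set.pi Set.univ (fun _ => Set.range ((↑) : ℚ → ℝ)) with hD
  have hDdense : Dense D := dense_pi Set.univ (fun _ _ => Rat.denseRange_cast)
  obtain ⟨δ, ⟨hδU, hδT⟩, hδD⟩ := hDdense.inter_open_nonempty (U ∩ T) (hUopen.inter hTopen) hne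
  have hq' : ∀ l, ∃ q : ℚ, (q : ℝ) = δ l := fun l => hδD l (Set.mem_univ l)
  choose q hq using hq'
  -- clear denominators: `N = ∏ den`, `z l = num l · ∏_{l' ≠ l} den l'`, so `(z l : ℝ) = N · δ l`
  set N : ℕ := ∏ l, (q l).den with hN
  have hNpos : 0 < N := Finset.prod_pos fun l _ => (q l).den_pos
  set z : Fin 6 → ℤ := fun l => (q l).num * ∏ l' ∈ univ.erase l, ((q l').den : ℤ) with hz
  have hzR : ∀ l, (z l : ℝ) = (N : ℝ) * δ l := by
    intro l
    have hsplit : (N : ℤ) = (q l).den * ∏ l' ∈ univ.erase l, ((q l').den : ℤ) := by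
      rw [hN]; push_cast
      rw [← Finset.mul_prod_erase univ (fun l' => ((q l').den : ℤ)) (mem_univ l)]
    have hnum : ((q l).num : ℝ) = (q l : ℝ) * (q l).den := by
      have h1 : ((q l) * (q l).den : ℚ) = (q l).num := Rat.mul_den_eq_num (q l)
      exact_mod_cast h1.symm
    have hsplitR : (N : ℝ) = ((q l).den : ℝ) * ((∏ l' ∈ univ.erase l, ((q l').den : ℤ) : ℤ) : ℝ) := by
      exact_mod_cast hsplit
    simp only [hz, Int.cast_mul, hnum, hsplitR, ← hq l]
    ring
  -- translate to non-negative integers: `e l = z l − zmin`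
  set zmin : ℤ := univ.inf' ⟨0, mem_univ _⟩ z with hzmin
  have hzmin_le : ∀ l, zmin ≤ z l := fun l => Finset.inf'_le z (mem_univ l)
  set e : Fin 6 → ℕ := fun l => (z l - zmin).toNat with he
  have heZ : ∀ l, (e l : ℤ) = z l - zmin := fun l => Int.toNat_of_nonneg (sub_nonneg.mpr (hzmin_le l))
  have heR : ∀ l, (e l : ℝ) = -(zmin : ℝ) + (N : ℝ) * δ l := by
    intro l
    have : ((e l : ℤ) : ℝ) = ((z l - zmin : ℤ) : ℝ) := by rw [heZ l]
    push_cast at this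
    rw [this, hzR l]; ring
  -- `e` inherits the strict pair-sum inequalities of `δ₀`
  have hinh : ∀ p q : Fin 6 × Fin 6, δ₀ p.1 + δ₀ p.2 < δ₀ q.1 + δ₀ q.2 → e p.1 + e p.2 < e q.1 + e q.2 := by
    intro p q hpq
    have h1 : δ p.1 + δ p.2 < δ q.1 + δ q.2 := hδU p q hpq
    have h2 : (e p.1 : ℝ) + e p.2 < e q.1 + e q.2 := by
      rw [heR, heR, heR, heR]
      have hNR : (0 : ℝ) < N := by exact_mod_cast hNpos
      nlinarith
    exact_mod_cast h2
  -- the row at `e`, transferred to real powers, contradicts `δ ∈ T` (affine invariance)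
  have hrow := h e hinh
  obtain ⟨S, hS, h20⟩ := hδT
  have hNR : (N : ℝ) ≠ 0 := by exact_mod_cast hNpos.ne'
  have haff := ncard_rpow_affine δ S (-(zmin : ℝ)) hNR
  have hcast : {x : ℝ | 0 < x ∧ (∑ l, (x ^ (-(zmin : ℝ) + (N : ℝ) * δ l)) • S l).det = 0}
      = {x : ℝ | 0 < x ∧ (∑ l, (x ^ ((e l : ℕ) : ℝ)) • S l).det = 0} := by
    ext x
    simp only [Set.mem_setOf_eq, heR]
  have hle := ncard_rpow_natCast_le_of_posRootLawOn e hrow S hS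
  rw [← hcast, haff] at hle
  omega

/-- **Only SORTED generic supports need rows** (for a monotone `δ₀`).  If every STRICTLY INCREASING support `d` inheriting
the strict pair-sum inequalities of `δ₀` on the canonical pairs `i ≤ j`, `k ≤ l` carries the row, then every support
inheriting them does: a support with a repeated exponent is free (`posRootLawOn_of_pairSum_collision`), and an injective
one is sorted by a permutation that FIXES `δ₀` (it is monotone for `δ₀`, `Tuple.unique_monotone`), rows being invariant
under relabelling (`posRootLawOn_comp_equiv_iff`). [this work] -/
theorem rows_of_sortedRows (δ₀ : Fin 6 → ℝ) (hδ₀ : Monotone δ₀)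
    (hs : ∀ d : Fin 6 → ℕ, StrictMono d →
      (∀ p q : Fin 6 × Fin 6, p.1 ≤ p.2 → q.1 ≤ q.2 → δ₀ p.1 + δ₀ p.2 < δ₀ q.1 + δ₀ q.2 →
        d p.1 + d p.2 < d q.1 + d q.2) →
      PosRootLawOn 2 6 19 d) :
    ∀ d : Fin 6 → ℕ,
      (∀ p q : Fin 6 × Fin 6, δ₀ p.1 + δ₀ p.2 < δ₀ q.1 + δ₀ q.2 → d p.1 + d p.2 < d q.1 + d q.2) →
      PosRootLawOn 2 6 19 d := by
  classical
  intro d hd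
  by_cases hinj : Function.Injective d
  · set π : Equiv.Perm (Fin 6) := Tuple.sort d with hπ
    have hmono : Monotone (d ∘ π) := Tuple.monotone_sort d
    have hstrict : StrictMono (d ∘ π) := hmono.strictMono_of_injective (hinj.comp π.injective)
    -- `δ₀ ∘ π` is monotone, hence equal to `δ₀`
    have hδπ : Monotone (δ₀ ∘ π) := by
      intro i j hij
      rcases hij.eq_or_lt with rfl | hlt
      · exact le_rfl
      · by_contra hcon
        push Not at hcon
        have h1 : d (π j) + d (π j) < d (π i) + d (π i) := hd (π j, π j) (π i, π i) (add_lt_add hcon hcon)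
        have h2 : d (π i) < d (π j) := hstrict hlt
        omega
    have hfix : δ₀ ∘ π = δ₀ := by
      have := Tuple.unique_monotone (f := δ₀) (σ := π) (τ := Equiv.refl _) hδπ
        (by simpa only [Equiv.coe_refl, Function.comp_id] using hδ₀)
      simpa only [Equiv.coe_refl, Function.comp_id] using this
    have hfix' : ∀ l, δ₀ (π l) = δ₀ l := fun l => congrFun hfix l
    have hd' : ∀ p q : Fin 6 × Fin 6, p.1 ≤ p.2 → q.1 ≤ q.2 → δ₀ p.1 + δ₀ p.2 < δ₀ q.1 + δ₀ q.2 →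
        (d ∘ π) p.1 + (d ∘ π) p.2 < (d ∘ π) q.1 + (d ∘ π) q.2 := by
      intro p q _ _ hpq
      have := hd (π p.1, π p.2) (π q.1, π q.2) (by simp only [hfix']; exact hpq)
      simpa only [Function.comp_apply] using this
    exact (posRootLawOn_comp_equiv_iff π d).mpr (hs (d ∘ π) hstrict hd')
  · -- a repeated exponent: two canonical pairs collide
    have : ∃ i j : Fin 6, d i = d j ∧ i ≠ j := by
      simp only [Function.Injective, not_forall, exists_prop] at hinj
      obtain ⟨i, j, hij, hne⟩ := hinj
      exact ⟨i, j, hij, hne⟩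
    obtain ⟨i, j, hij, hne⟩ := this
    rcases lt_or_gt_of_ne hne with hlt | hlt
    · exact posRootLawOn_of_pairSum_collision d (i, i) (i, j) le_rfl hlt.le
        (fun h => hne (Prod.mk.inj h).2) (by rw [hij])
    · exact posRootLawOn_of_pairSum_collision d (j, j) (j, i) le_rfl hlt.le
        (fun h => hne (Prod.mk.inj h).2.symm) (by rw [hij])

/-- **Bridge, sorted form.**  For a MONOTONE `δ₀ ∈ ℝ⁶` (e.g. a point of the sorted simplex): if every strictly increasing
integer support inheriting the strict canonical pair-sum inequalities of `δ₀` carries the door-A row, then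
`δ₀ ∉ closure TwentyLocus`. [this work] -/
theorem not_mem_closure_twentyLocus_of_sortedRows (δ₀ : Fin 6 → ℝ) (hδ₀ : Monotone δ₀)
    (hs : ∀ d : Fin 6 → ℕ, StrictMono d →
      (∀ p q : Fin 6 × Fin 6, p.1 ≤ p.2 → q.1 ≤ q.2 → δ₀ p.1 + δ₀ p.2 < δ₀ q.1 + δ₀ q.2 →
        d p.1 + d p.2 < d q.1 + d q.2) →
      PosRootLawOn 2 6 19 d) :
    δ₀ ∉ closure {δ : Fin 6 → ℝ | ∃ S : Fin 6 → Matrix (Fin 2) (Fin 2) ℝ, (∀ l, (S l).IsSymm) ∧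
      20 ≤ {x : ℝ | 0 < x ∧ (∑ l, (x ^ (δ l)) • S l).det = 0}.ncard} :=
  not_mem_closure_twentyLocus_of_rows δ₀ (rows_of_sortedRows δ₀ hδ₀ hs)

/-- **A point of the open cone of a chamber with a kernel row is not in the closure of the twenty-locus.**  If the pair sums
of `δ₀` increase STRICTLY along an order `σ` of index pairs and the chamber-uniform row of `σ` holds
(`∀ d, StrictMono (pairSum d ∘ σ) → PosRootLawOn 2 6 19 d` — the shape of the census theorems `doorA26_on_chamber<n>`),
then `δ₀ ∉ closure TwentyLocus`. [this work] -/
theorem not_mem_closure_twentyLocus_of_chamberRow (δ₀ : Fin 6 → ℝ) (σ : Fin 21 → Fin 6 × Fin 6)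
    (hδ₀ : StrictMono ((fun p : Fin 6 × Fin 6 => δ₀ p.1 + δ₀ p.2) ∘ σ))
    (hrow : ∀ d : Fin 6 → ℕ, StrictMono ((fun p : Fin 6 × Fin 6 => d p.1 + d p.2) ∘ σ) → PosRootLawOn 2 6 19 d) :
    δ₀ ∉ closure {δ : Fin 6 → ℝ | ∃ S : Fin 6 → Matrix (Fin 2) (Fin 2) ℝ, (∀ l, (S l).IsSymm) ∧
      20 ≤ {x : ℝ | 0 < x ∧ (∑ l, (x ^ (δ l)) • S l).det = 0}.ncard} :=
  not_mem_closure_twentyLocus_of_rows δ₀ fun d hd => hrow d fun s t hst => hd (σ s) (σ t) (hδ₀ hst)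

/-- **By chamber id.**  Same, for chamber `n` of the cell's table `Census.chamber` (so a landed row `doorA26_on_chamber<n>` is
passed verbatim as `hrow`): every real exponent vector in the open cone of a CERTIFIED chamber is outside `closure TwentyLocus`.
[this work] -/
theorem not_mem_closure_twentyLocus_of_chamber (δ₀ : Fin 6 → ℝ) (n : ℕ)
    (hδ₀ : StrictMono ((fun p : Fin 6 × Fin 6 => δ₀ p.1 + δ₀ p.2) ∘ chamber n))
    (hrow : ∀ d : Fin 6 → ℕ, StrictMono ((fun p : Fin 6 × Fin 6 => d p.1 + d p.2) ∘ chamber n) →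
      PosRootLawOn 2 6 19 d) :
    δ₀ ∉ closure {δ : Fin 6 → ℝ | ∃ S : Fin 6 → Matrix (Fin 2) (Fin 2) ℝ, (∀ l, (S l).IsSymm) ∧
      20 ≤ {x : ℝ | 0 < x ∧ (∑ l, (x ^ (δ l)) • S l).det = 0}.ncard} :=
  not_mem_closure_twentyLocus_of_chamberRow δ₀ (chamber n) hδ₀ hrow

end Bridge

section WallBubbling

open Summit.ValiantsHypothesis.ValiantsHypothesis.Theorems.LacunarySymmetroidMatrixDescartes.WallBubbling

/-- **The bridge in the W-line's currency** (`Bubbling.TwentyLocus` of `…DoorA26WallBubblingBubblingDefs`, the set used by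
`tripleStratum26_of_chains` & co.). [this work] -/
theorem not_mem_closure_bubblingTwentyLocus_of_rows (δ₀ : Fin 6 → ℝ)
    (h : ∀ d : Fin 6 → ℕ,
      (∀ p q : Fin 6 × Fin 6, δ₀ p.1 + δ₀ p.2 < δ₀ q.1 + δ₀ q.2 → d p.1 + d p.2 < d q.1 + d q.2) →
      PosRootLawOn 2 6 19 d) :
    δ₀ ∉ closure Bubbling.TwentyLocus :=
  not_mem_closure_twentyLocus_of_rows δ₀ h

/-- **The bridge in the W-line's currency, sorted form** (points of `Bubbling.SortedSimplex` are monotone). [this work] -/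
theorem not_mem_closure_bubblingTwentyLocus_of_sortedRows (δ₀ : Fin 6 → ℝ) (hδ₀ : Monotone δ₀)
    (hs : ∀ d : Fin 6 → ℕ, StrictMono d →
      (∀ p q : Fin 6 × Fin 6, p.1 ≤ p.2 → q.1 ≤ q.2 → δ₀ p.1 + δ₀ p.2 < δ₀ q.1 + δ₀ q.2 →
        d p.1 + d p.2 < d q.1 + d q.2) →
      PosRootLawOn 2 6 19 d) :
    δ₀ ∉ closure Bubbling.TwentyLocus :=
  not_mem_closure_twentyLocus_of_sortedRows δ₀ hδ₀ hs

/-- **Certified chambers are invisible to the W-line's accumulation analysis**: a sorted-simplex point in the open cone of a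
chamber whose row is in the kernel is outside `closure Bubbling.TwentyLocus`. [this work] -/
theorem not_mem_closure_bubblingTwentyLocus_of_chamber (δ₀ : Fin 6 → ℝ) (n : ℕ)
    (hδ₀ : StrictMono ((fun p : Fin 6 × Fin 6 => δ₀ p.1 + δ₀ p.2) ∘ chamber n))
    (hrow : ∀ d : Fin 6 → ℕ, StrictMono ((fun p : Fin 6 × Fin 6 => d p.1 + d p.2) ∘ chamber n) →
      PosRootLawOn 2 6 19 d) :
    δ₀ ∉ closure Bubbling.TwentyLocus :=
  not_mem_closure_twentyLocus_of_chamber δ₀ n hδ₀ hrow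

end WallBubbling

end Summit.ValiantsHypothesis.ValiantsHypothesis.Theorems.LacunarySymmetroidMatrixDescartes.Census.RealExp
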